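import Mathlib
import Literature.NumberTheory.LFunctions.MertensOneSided
import Literature.NumberTheory.LFunctions.LiouvilleSumClassicalBound
import HarnessLib

/-!
# One-sided bounds on `L(x)/√x`: Landau's theorem and the Laplace transform of `A(u) = L(e^u)e^{-u/2}`

Topic `Literature/NumberTheory/LFunctions` (trunk T-ANT). The number-theoretic input of Ingham's
kernel method for **Pólya's sum** `L(x) = Σ_{n ≤ x} λ(n)` (the tree's `liouvilleSum`), in the form
consumed by the abstract oscillation theorem
`Literature.NumberTheory.LFunctions.InghamSmoothing.frequently_gt_and_lt_of_laplace` (`InghamSmoothing.lean`) — the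
exact analogue, for `λ` in place of `μ`, of `MertensOneSided.lean` (whose structure and proofs are
followed line by line): under a one-sided bound on `A(u) = e^{-u/2} L(e^u)` (Borwein–Ferguson–
Mossinghoff 2008, (3); Ingham 1942) the damped functions `A(u)e^{-σu}` are integrable for every
`σ > 0` and the Laplace transform of `A` is `ζ(1+2s)/((½+s)ζ(½+s))` on `0 < Re s < ½`, which is
`F(½+s)/(½+s)` for `F(w) = ζ(2w)/ζ(w) = Σ λ(n) n^{-w}` ((1) of BFM 2008).

## Main results (all proved)

* `LSeries_liouville_eq` — `Σ λ(n) n^{-s} = ζ(2s)/ζ(s)` for `Re s > 1` (BFM 2008 (1)), from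
  `ζ ⋆ λ = 𝟙_□` (`zeta_mul_liouville_apply`, `LiouvilleSumClassicalBound.lean`) and
  `Σ_{n = □} n^{-s} = ζ(2s)`.
* `mellin_liouvilleSum` — `∫_{(1,∞)} L(x) x^{-(s+1)} dx = ζ(2s)/(sζ(s))` for `Re s > 1`
  (Mathlib's `LSeries_eq_mul_integral'`).
* `integrableOn_liouville_rpow_of_oneSided` — **Landau's theorem applied to `L`**: a one-sided
  bound `±L(x) ≤ A√x` (`x ≥ x₁`) gives `∫_1^∞ |L(x)| x^{-σ-1} dx < ∞` for every `σ > ½`: the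
  non-negative function `g = A√x ∓ L` has transform `A/(s-½) ∓ ζ(2s)/(sζ(s))`, holomorphic on a
  neighbourhood of the real ray `(½, ∞)` (no real zeros of `ζ` on `(½, 1)`, removable singularity of
  `1/ζ` at `1`, `ζ(2s)` holomorphic off `s = ½`), so Landau's lemma
  (`Literature.NumberTheory.LFunctions.Landau.integrableOn_of_differentiableOn_union_convex`, `LandauOscillation.lean`) applies.
  This is the analytic content of "Ingham noted that the Riemann hypothesis and the simplicity of
  the zeros follow if either `L(n) < c√n` or `L(n) > -c√n`" (BFM 2008, §1, p. 1682).
* `mellin_liouville_mul_eq`, `riemannZeta_ne_zero_of_liouville_integrable` — continuation of the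
  representation to `Re s > ½` (identity theorem on convex pieces), whence `ζ ≠ 0` there.
* `laplace_normalizedLiouville_eq_mellin`, `integrable_normalizedLiouville_damped_iff` — the
  substitution `x = e^u`.
* `normalizedLiouville_laplace_of_oneSided` — the packaged statement fed to the abstract theorem.

## References

* [BorweinFergusonMossinghoff2008] P. Borwein, R. Ferguson, M. J. Mossinghoff, *Sign changes in
  sums of the Liouville function*, Math. Comp. 77 (2008), 1681–1694: §1, (1) p. 1681, (3)–(5)
  p. 1683, and p. 1682 (Ingham's remark).
* [Ingham1942] A. E. Ingham, *On two conjectures in the theory of numbers*, Amer. J. Math. 64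
  (1942), 313–319.
* [BatemanDiamond2004] P. T. Bateman, H. G. Diamond, *Analytic Number Theory*, §11.5–11.7 (the
  template followed for `M`).
* [MontgomeryVaughan2007] H. L. Montgomery, R. C. Vaughan, *Multiplicative Number Theory I*,
  §15.1 Lemma 15.1 (Landau).
-/

noncomputable section

open Complex Filter Asymptotics MeasureTheory Set ArithmeticFunction
open scoped Real Topology LSeries.notation ArithmeticFunction.zeta

namespace Literature.NumberTheory.LFunctions

open LiouvilleSum

/-! ## `L(x)`: elementary facts -/

/-- `L(x) = Σ_{1 ≤ n ≤ x} λ(n)` written over `Finset.Icc 1 ⌊x⌋₊` (the indexing of Mathlib's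
`LSeries_eq_mul_integral`). [folklore] -/
theorem liouvilleSum_eq_sum_Icc (x : ℝ) :
    liouvilleSum x = ∑ n ∈ Finset.Icc 1 ⌊x⌋₊, liouville n := by
  unfold liouvilleSum
  rw [← Finset.Icc_add_one_left_eq_Ioc, zero_add]

/-- `L(x) = 0` for `x < 1`. [folklore] -/
theorem liouvilleSum_of_lt_one {x : ℝ} (hx : x < 1) : liouvilleSum x = 0 := by
  unfold liouvilleSum
  rw [Nat.floor_eq_zero.2 hx]
  simp

/-- The trivial bound `|L(x)| ≤ x` for `x ≥ 0`. [folklore] -/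
theorem abs_liouvilleSum_le {x : ℝ} (hx : 0 ≤ x) : |(liouvilleSum x : ℝ)| ≤ x := by
  unfold liouvilleSum
  push_cast
  exact (abs_sum_liouville_le ⌊x⌋₊).trans (Nat.floor_le hx)

/-- `x ↦ L(x)` is measurable (a function of `⌊x⌋₊`). [folklore] -/
theorem measurable_liouvilleSum : Measurable (fun x : ℝ ↦ (liouvilleSum x : ℝ)) := by
  have : (fun x : ℝ ↦ (liouvilleSum x : ℝ)) =
      (fun n : ℕ ↦ ((∑ k ∈ Finset.Ioc 0 n, liouville k : ℤ) : ℝ)) ∘ Nat.floor := by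
    ext x; rfl
  rw [this]
  exact measurable_from_nat.comp Nat.measurable_floor

/-! ## The Dirichlet series `Σ λ(n) n^{-s} = ζ(2s)/ζ(s)` ((1) of BFM 2008) -/

/-- `Σ_{n = □, n ≥ 1} n^{-s} = ζ(2s)` for `Re s > 1`: the `L`-series of the indicator of the squares.
[folklore] -/
theorem LSeries_indicator_isSquare {s : ℂ} (hs : 1 < s.re) :
    LSeries (fun n ↦ if IsSquare n then (1 : ℂ) else 0) s = riemannZeta (2 * s) := by
  have hs2 : 1 < (2 * s).re := by simp; linarith
  have hs0 : 2 * s ≠ 0 := by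
    intro h; rw [h] at hs2; simp at hs2; linarith
  rw [zeta_eq_tsum_one_div_nat_cpow hs2, LSeries]
  set f : ℕ → ℂ := fun n ↦ if IsSquare n then (1 : ℂ) else 0 with hf
  have hinj : Function.Injective fun m : ℕ ↦ m * m := fun a b h ↦ Nat.mul_self_inj.1 h
  have hsupp : Function.support (LSeries.term f s) ⊆ Set.range fun m : ℕ ↦ m * m := by
    intro n hn
    rw [Function.mem_support] at hn
    have hn0 : n ≠ 0 := by
      rintro rfl; exact hn (LSeries.term_zero f s)
    rw [LSeries.term_of_ne_zero hn0] at hn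
    have hsq : IsSquare n := by
      by_contra h
      simp [hf, h] at hn
    obtain ⟨r, hr⟩ := hsq
    exact ⟨r, hr.symm⟩
  rw [← hinj.tsum_eq hsupp]
  refine tsum_congr fun m ↦ ?_
  rcases Nat.eq_zero_or_pos m with rfl | hm
  · simp [LSeries.term_zero, Complex.zero_cpow hs0]
  · have hm0 : (m : ℂ) ≠ 0 := by exact_mod_cast hm.ne'
    have hmm : m * m ≠ 0 := Nat.mul_ne_zero hm.ne' hm.ne'
    rw [LSeries.term_of_ne_zero hmm]
    simp only [hf, if_pos (IsSquare.mul_self m), Nat.cast_mul, Complex.natCast_mul_natCast_cpow,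
      two_mul, Complex.cpow_add _ _ hm0]

/-- `(ζ ⋆ λ)(n) = [n is a square]` for `n ≠ 0`, complex-valued arithmetic functions.
[folklore] -/
theorem zeta_mul_liouville_complex_apply {n : ℕ} (hn : n ≠ 0) :
    ((ζ : ArithmeticFunction ℂ) * (liouville : ArithmeticFunction ℂ)) n =
      if IsSquare n then 1 else 0 := by
  rw [coe_zeta_mul_apply]
  simp_rw [intCoe_apply]
  rw [← Int.cast_sum, sum_divisors_liouville hn]
  split_ifs <;> simp

/-- `Σ λ(n) n^{-s}` converges absolutely for `Re s > 1` (`|λ| ≤ 1`). [folklore] -/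
theorem LSeriesSummable_liouville {s : ℂ} (hs : 1 < s.re) :
    LSeriesSummable (fun n ↦ ((liouville n : ℤ) : ℂ)) s := by
  refine LSeriesSummable_of_bounded_of_one_lt_re (m := 1) (fun n _ ↦ ?_) hs
  rw [Complex.norm_intCast]
  exact_mod_cast abs_liouville_le_one n

/-- **`Σ_{n ≥ 1} λ(n) n^{-s} = ζ(2s)/ζ(s)` for `Re s > 1`** (BFM 2008, (1); Titchmarsh (1.2.11)):
from `ζ(s) · Σ λ(n)n^{-s} = Σ_{n=□} n^{-s} = ζ(2s)` (`ζ ⋆ λ = 𝟙_□`).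
[cite: BorweinFergusonMossinghoff2008, §1 (1) p. 1681] -/
theorem LSeries_liouville_eq {s : ℂ} (hs : 1 < s.re) :
    LSeries (fun n ↦ ((liouville n : ℤ) : ℂ)) s = riemannZeta (2 * s) / riemannZeta s := by
  have hζ : LSeriesSummable (fun n ↦ (ζ : ArithmeticFunction ℂ) n) s := by
    refine LSeriesSummable_of_bounded_of_one_lt_re (m := 1) (fun n hn ↦ ?_) hs
    rw [natCoe_apply, zeta_apply_ne hn]; simp
  have hl' : LSeriesSummable (fun n ↦ (liouville : ArithmeticFunction ℂ) n) s := by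
    have : (fun n ↦ (liouville : ArithmeticFunction ℂ) n) = fun n ↦ ((liouville n : ℤ) : ℂ) := by
      ext n; rw [intCoe_apply]
    rw [this]; exact LSeriesSummable_liouville hs
  have hmul := LSeries_mul' hζ hl'
  have hlhs : LSeries (fun n ↦ ((ζ : ArithmeticFunction ℂ) * (liouville : ArithmeticFunction ℂ)) n) s
      = riemannZeta (2 * s) := by
    rw [← LSeries_indicator_isSquare hs]
    exact LSeries_congr (fun hn ↦ zeta_mul_liouville_complex_apply hn) s
  have hz : LSeries (fun n ↦ (ζ : ArithmeticFunction ℂ) n) s = riemannZeta s := by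
    rw [← LSeries_zeta_eq_riemannZeta hs]
    exact LSeries_congr (fun _ ↦ by rw [natCoe_apply]) s
  have hl : LSeries (fun n ↦ (liouville : ArithmeticFunction ℂ) n) s
      = LSeries (fun n ↦ ((liouville n : ℤ) : ℂ)) s :=
    LSeries_congr (fun _ ↦ by rw [intCoe_apply]) s
  rw [hlhs, hz, hl] at hmul
  have hζ0 : riemannZeta s ≠ 0 := riemannZeta_ne_zero_of_one_lt_re hs
  field_simp
  rw [hmul]; ring

/-! ## The Mellin transform of `L`: `∫_1^∞ L(x) x^{-s-1} dx = ζ(2s)/(s ζ(s))` for `Re s > 1` -/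

/-- **The Mellin transform of `L`** (partial summation in (1), BFM 2008 §1: "applying partial
summation in (1)"; the formula `F(s) = ζ(2s)/ζ(s) = s ∫_1^∞ L(x) x^{-s-1} dx`, `σ > 1`): in the
normalisation of `LandauOscillation.lean`, `∫_{(1,∞)} L(x) x^{-(s+1)} dx = ζ(2s)/(s ζ(s))` for
`Re s > 1`. From Mathlib's `LSeries_eq_mul_integral'`. [cite: BorweinFergusonMossinghoff2008, §1 p. 1681] -/
theorem mellin_liouvilleSum {s : ℂ} (hs : 1 < s.re) :
    Landau.mellinIoi (fun x ↦ (liouvilleSum x : ℝ)) s = riemannZeta (2 * s) / (s * riemannZeta s) := by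
  have hO : (fun n : ℕ ↦ ∑ k ∈ Finset.Icc 1 n, ‖((liouville k : ℤ) : ℂ)‖) =O[atTop]
      fun n ↦ (n : ℝ) ^ (1 : ℝ) := by
    refine IsBigO.of_bound 1 (Eventually.of_forall fun n ↦ ?_)
    rw [Real.norm_eq_abs, Real.norm_eq_abs, Real.rpow_one, one_mul, Nat.abs_cast,
      abs_of_nonneg (Finset.sum_nonneg fun k _ ↦ norm_nonneg _)]
    calc ∑ k ∈ Finset.Icc 1 n, ‖((liouville k : ℤ) : ℂ)‖
        ≤ ∑ k ∈ Finset.Icc 1 n, (1 : ℝ) := Finset.sum_le_sum fun k _ ↦ by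
          rw [Complex.norm_intCast]
          exact_mod_cast abs_liouville_le_one k
      _ = n := by simp
  have hs' : (1 : ℝ) < s.re := hs
  have hint := LSeries_eq_mul_integral' (fun n ↦ ((liouville n : ℤ) : ℂ)) zero_le_one hs' hO
  rw [LSeries_liouville_eq hs] at hint
  have hL : ∀ t : ℝ, (((liouvilleSum t : ℝ)) : ℂ) =
      ∑ k ∈ Finset.Icc 1 ⌊t⌋₊, ((liouville k : ℤ) : ℂ) := by
    intro t; rw [liouvilleSum_eq_sum_Icc]; push_cast; rfl
  unfold Landau.mellinIoi
  simp_rw [hL]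
  have hs0 : s ≠ 0 := by rintro rfl; simp at hs'; linarith
  have hζ : riemannZeta s ≠ 0 := riemannZeta_ne_zero_of_one_lt_re hs
  have : (∫ t in Set.Ioi (1 : ℝ), (∑ k ∈ Finset.Icc 1 ⌊t⌋₊, ((liouville k : ℤ) : ℂ)) *
      (t : ℂ) ^ (-(s + 1))) = riemannZeta (2 * s) / riemannZeta s / s := by
    rw [eq_div_iff hs0, mul_comm, ← hint]
  rw [this]
  field_simp

/-! ## `A(u) = L(e^u) e^{-u/2}` ((3) of BFM 2008) -/

/-- `A(x) = e^{-x/2} L(e^x)` (Borwein–Ferguson–Mossinghoff (3), after Ingham and Haselgrove): the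
function to which the abstract oscillation theorem of `InghamSmoothing.lean` is applied.
[cite: BorweinFergusonMossinghoff2008, §1 (3) p. 1683] -/
def normalizedLiouville (u : ℝ) : ℝ :=
  (liouvilleSum (Real.exp u) : ℝ) * Real.exp (-(u / 2))

/-- `A = 0` on `(-∞, 0)` (`e^u < 1`). [cite: BorweinFergusonMossinghoff2008, §1 (3) p. 1683] -/
theorem normalizedLiouville_of_neg {u : ℝ} (hu : u < 0) : normalizedLiouville u = 0 := by
  unfold normalizedLiouville
  rw [liouvilleSum_of_lt_one (Real.exp_lt_one_iff.2 hu)]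
  simp

/-- `|A(u)| ≤ e^{u/2}` (from `|L(x)| ≤ x`). [folklore] -/
theorem abs_normalizedLiouville_le (u : ℝ) : |normalizedLiouville u| ≤ Real.exp (u / 2) := by
  unfold normalizedLiouville
  rw [abs_mul, abs_of_pos (Real.exp_pos _)]
  calc |(liouvilleSum (Real.exp u) : ℝ)| * Real.exp (-(u / 2))
      ≤ Real.exp u * Real.exp (-(u / 2)) :=
        mul_le_mul_of_nonneg_right (abs_liouvilleSum_le (Real.exp_pos u).le) (Real.exp_pos _).le
    _ = Real.exp (u / 2) := by rw [← Real.exp_add]; congr 1; ring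

/-- `A` is measurable. [folklore] -/
theorem measurable_normalizedLiouville : Measurable normalizedLiouville :=
  (measurable_liouvilleSum.comp Real.measurable_exp).mul
    (Real.measurable_exp.comp (measurable_id.div_const 2).neg)

/-- `A` is locally bounded: `|A(u)| ≤ e^{b/2}` for `u ≤ b`. [folklore] -/
theorem normalizedLiouville_locally_bounded (b : ℝ) :
    ∃ B : ℝ, ∀ u, u ≤ b → |normalizedLiouville u| ≤ B :=
  ⟨Real.exp (b / 2), fun u hu ↦ (abs_normalizedLiouville_le u).trans (Real.exp_le_exp.2 (by linarith))⟩

/-- From `A(y) > a` frequently as `y → ∞` to `L(x) > a √x` frequently as `x → ∞` (`x = e^y`).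
[cite: BorweinFergusonMossinghoff2008, §1 (3)–(5) p. 1683] -/
theorem frequently_liouville_gt_of_normalizedLiouville {a : ℝ}
    (h : ∃ᶠ y : ℝ in atTop, a < normalizedLiouville y) :
    ∃ᶠ x : ℝ in atTop, a * Real.sqrt x < liouvilleSum x := by
  rw [← Real.map_exp_atTop, Filter.frequently_map]
  refine h.mono fun y hy ↦ ?_
  have hpos : 0 < Real.exp (y / 2) := Real.exp_pos _
  rw [← Real.exp_half]
  unfold normalizedLiouville at hy
  rwa [Real.exp_neg, ← div_eq_mul_inv, lt_div_iff₀ hpos] at hy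

/-- From `A(y) < a` frequently as `y → ∞` to `L(x) < a √x` frequently as `x → ∞`.
[cite: BorweinFergusonMossinghoff2008, §1 (3)–(5) p. 1683] -/
theorem frequently_liouville_lt_of_normalizedLiouville {a : ℝ}
    (h : ∃ᶠ y : ℝ in atTop, normalizedLiouville y < a) :
    ∃ᶠ x : ℝ in atTop, (liouvilleSum x : ℝ) < a * Real.sqrt x := by
  rw [← Real.map_exp_atTop, Filter.frequently_map]
  refine h.mono fun y hy ↦ ?_
  have hpos : 0 < Real.exp (y / 2) := Real.exp_pos _
  rw [← Real.exp_half]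
  unfold normalizedLiouville at hy
  rwa [Real.exp_neg, ← div_eq_mul_inv, div_lt_iff₀ hpos] at hy

/-- `A(log x) = L(x)/√x` for `x > 0`. [cite: BorweinFergusonMossinghoff2008, §1 (3) p. 1683] -/
theorem normalizedLiouville_log {x : ℝ} (hx : 0 < x) :
    normalizedLiouville (Real.log x) = (liouvilleSum x : ℝ) / Real.sqrt x := by
  unfold normalizedLiouville
  rw [Real.exp_log hx, Real.exp_neg, exp_log_half hx, div_eq_mul_inv]

/-- A one-sided bound `A ≤ a` gives `L(x) ≤ a √x` for `x > 0`. [folklore] -/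
theorem liouville_le_of_normalizedLiouville_le {a : ℝ} (h : ∀ u, normalizedLiouville u ≤ a) {x : ℝ}
    (hx : 0 < x) : (liouvilleSum x : ℝ) ≤ a * Real.sqrt x := by
  have h1 := h (Real.log x)
  rw [normalizedLiouville_log hx, div_le_iff₀ (Real.sqrt_pos.2 hx)] at h1
  exact h1

/-- A one-sided bound `-a ≤ A` gives `-(a √x) ≤ L(x)` for `x > 0`. [folklore] -/
theorem liouville_ge_of_le_normalizedLiouville {a : ℝ} (h : ∀ u, -a ≤ normalizedLiouville u) {x : ℝ}
    (hx : 0 < x) : -(a * Real.sqrt x) ≤ (liouvilleSum x : ℝ) := by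
  have h1 := h (Real.log x)
  rw [normalizedLiouville_log hx, le_div_iff₀ (Real.sqrt_pos.2 hx)] at h1
  linarith

/-! ## The substitution `x = e^u` -/

/-- The Mellin integrand of `L` vanishes a.e. off `(1, ∞)`. [folklore] -/
theorem liouville_integrand_ae_zero {E : Type*} [NormedAddCommGroup E] [NormedSpace ℝ E] (φ : ℝ → E) :
    ∀ᵐ x : ℝ, x ∉ Set.Ioi (1 : ℝ) → (liouvilleSum x : ℝ) • φ x = 0 := by
  have h1 : ∀ᵐ x : ℝ, x ≠ 1 := by
    have : (volume : Measure ℝ) {1} = 0 := measure_singleton 1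
    filter_upwards [compl_mem_ae_iff.2 this] with x hx
    simpa using hx
  filter_upwards [h1] with x hx hx1
  have : x < 1 := lt_of_le_of_ne (not_lt.1 hx1) hx
  rw [liouvilleSum_of_lt_one this]; simp

/-- **The Laplace transform of `A` is the Mellin transform of `L`**:
`∫_ℝ A(u) e^{-(s-½)u} du = ∫_{(1,∞)} L(x) x^{-(s+1)} dx` for every `s` (both sides are `0` when
the integrals diverge). [cite: BorweinFergusonMossinghoff2008, §1 (3) p. 1683] -/
theorem laplace_normalizedLiouville_eq_mellin (s : ℂ) :
    ∫ u : ℝ, (normalizedLiouville u : ℂ) * cexp (-((s - 1 / 2) * u)) =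
      Landau.mellinIoi (fun x ↦ (liouvilleSum x : ℝ)) s := by
  unfold Landau.mellinIoi
  set G : ℝ → ℂ := fun x ↦ (((liouvilleSum x : ℝ)) : ℂ) * (x : ℂ) ^ (-(s + 1)) with hG
  have h0 : ∫ x in Set.Ioi (1 : ℝ), G x = ∫ x in Set.Ioi (0 : ℝ), G x := by
    rw [setIntegral_eq_integral_of_ae_compl_eq_zero, setIntegral_eq_integral_of_ae_compl_eq_zero]
    · filter_upwards with x hx
      have : x < 1 := by simp only [Set.mem_Ioi, not_lt] at hx; linarith
      simp only [hG, liouvilleSum_of_lt_one this]; simp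
    · filter_upwards [liouville_integrand_ae_zero (fun x : ℝ ↦ (x : ℂ) ^ (-(s + 1)))] with x hx hx1
      have := hx hx1
      simp only [hG]
      rw [← Complex.real_smul] ; exact_mod_cast this
  rw [h0, integral_Ioi_eq_integral_exp]
  refine integral_congr_ae (ae_of_all _ fun u ↦ ?_)
  simp only [hG]
  unfold normalizedLiouville
  rw [ofReal_exp_cpow, Complex.real_smul]
  push_cast
  have e : cexp (-((u : ℂ) / 2)) * cexp (-((s - 1 / 2) * (u : ℂ))) =
      cexp (u : ℂ) * cexp ((u : ℂ) * -(s + 1)) := by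
    rw [← Complex.exp_add, ← Complex.exp_add]; congr 1; ring
  linear_combination (↑(liouvilleSum (Real.exp u)) : ℂ) * e

/-- Integrability transfers likewise: for real `σ`, `u ↦ A(u) e^{-σu}` is integrable on `ℝ` iff
`x ↦ L(x) x^{-(σ+½+1)}` is integrable on `(1, ∞)`. [folklore] -/
theorem integrable_normalizedLiouville_damped_iff (σ : ℝ) :
    Integrable (fun u : ℝ ↦ normalizedLiouville u * Real.exp (-(σ * u))) ↔
      IntegrableOn (fun x : ℝ ↦ (liouvilleSum x : ℝ) * x ^ (-((σ + 1 / 2) + 1))) (Set.Ioi 1) := by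
  set G : ℝ → ℝ := fun x ↦ (liouvilleSum x : ℝ) * x ^ (-((σ + 1 / 2) + 1)) with hG
  have h1 : IntegrableOn G (Set.Ioi 1) ↔ IntegrableOn G (Set.Ioi 0) := by
    constructor
    · intro h
      have hsplit : Set.Ioi (0 : ℝ) = Set.Ioc 0 1 ∪ Set.Ioi 1 := (Set.Ioc_union_Ioi_eq_Ioi zero_le_one).symm
      rw [hsplit]
      refine IntegrableOn.union ?_ h
      refine (integrableOn_zero).congr_fun_ae ?_
      rw [EventuallyEq, ae_restrict_iff' measurableSet_Ioc]
      filter_upwards [liouville_integrand_ae_zero (fun x : ℝ ↦ x ^ (-((σ + 1 / 2) + 1)))] with x hx hx1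
      have : x ∉ Set.Ioi (1 : ℝ) := by simp only [Set.mem_Ioi, not_lt]; exact hx1.2
      have := hx this
      rw [smul_eq_mul] at this
      simp only [hG]
      exact this.symm
    · exact fun h ↦ h.mono_set (Set.Ioi_subset_Ioi zero_le_one)
  rw [h1, integrableOn_Ioi_iff_integrable_exp]
  refine integrable_congr (ae_of_all _ fun u ↦ ?_)
  simp only [hG, smul_eq_mul]
  unfold normalizedLiouville
  rw [Real.rpow_def_of_pos (Real.exp_pos u), Real.log_exp]
  have : Real.exp u * ((liouvilleSum (Real.exp u) : ℝ) * Real.exp (u * -((σ + 1 / 2) + 1))) =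
      (liouvilleSum (Real.exp u) : ℝ) * (Real.exp u * Real.exp (u * -((σ + 1 / 2) + 1))) := by ring
  rw [this, ← Real.exp_add, mul_assoc, ← Real.exp_add]
  congr 2; ring

/-- Integrability of the Mellin integrand of `L` for `Re s > 1` (trivial bound `|L(x)| ≤ x`).
[folklore] -/
theorem integrableOn_liouville_mul_cpow {s : ℂ} (hs : 1 < s.re) :
    IntegrableOn (fun x : ℝ ↦ (((liouvilleSum x : ℝ)) : ℂ) * (x : ℂ) ^ (-(s + 1))) (Set.Ioi 1) := by
  refine Integrable.mono' ((integrableOn_Ioi_rpow_of_lt (show -s.re < -1 by linarith) zero_lt_one))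
    ?_ ?_
  · exact ((Complex.continuous_ofReal.measurable.comp measurable_liouvilleSum).mul
      (Complex.measurable_ofReal.pow_const _)).aestronglyMeasurable
  · rw [ae_restrict_iff' measurableSet_Ioi]
    refine ae_of_all _ fun x hx ↦ ?_
    have hx0 : 0 < x := by simp only [Set.mem_Ioi] at hx; linarith
    rw [norm_mul, Complex.norm_real, Real.norm_eq_abs,
      Complex.norm_cpow_eq_rpow_re_of_pos hx0]
    calc |(liouvilleSum x : ℝ)| * x ^ (-(s + 1)).re ≤ x * x ^ (-(s + 1)).re :=
          mul_le_mul_of_nonneg_right (abs_liouvilleSum_le hx0.le) (Real.rpow_nonneg hx0.le _)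
      _ = x ^ (-s.re) := by
          rw [show (-(s + 1)).re = -s.re - 1 by simp; ring, Real.rpow_sub hx0, Real.rpow_one]
          field_simp

/-! ## Landau's theorem: a one-sided bound on `L(x)/√x` forces absolute convergence for `σ > ½` -/

/-- **Landau's theorem applied to `L`** (the analytic content of Ingham's remark "the Riemann
hypothesis and the simplicity of the zeros follow more generally if either `L(n) < c√n` or
`L(n) > -c√n`", BFM 2008 §1 p. 1682, in the integrated form of Bateman–Diamond Lemma 11.16): a
one-sided bound `η L(x) ≤ A√x` for `x ≥ x₁` (`η = ±1`) gives `∫_1^∞ |L(x)| x^{-σ-1} dx < ∞` for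
every `σ > ½`. The non-negative function `g(x) = A√x - η L(x)` has Mellin transform
`A/(s-½) - η ζ(2s)/(sζ(s))`, holomorphic on a neighbourhood of the real ray `(½, ∞)` (no zeros of
`ζ` in a thin rectangle about `[½, 4]`, `exists_zetaZeroFree_rect`; the removable singularity of
`1/ζ` at `1`, `differentiableAt_zetaInv`; `ζ(2s)` holomorphic for `s ≠ ½`), so Landau's lemma
(`LandauOscillation.lean`, MV Lemma 15.1) applies.
[cite: BorweinFergusonMossinghoff2008, §1 p. 1682; MontgomeryVaughan2007, §15.1 Lemma 15.1] -/
theorem integrableOn_liouville_rpow_of_oneSided {A x₁ η : ℝ} (hη : η = 1 ∨ η = -1)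
    (hb : ∀ x, x₁ ≤ x → η * (liouvilleSum x : ℝ) ≤ A * Real.sqrt x) {σ : ℝ} (hσ : 1 / 2 < σ) :
    IntegrableOn (fun x ↦ (liouvilleSum x : ℝ) * x ^ (-(σ + 1))) (Set.Ioi 1) := by
  have hηsq : η * η = 1 := by rcases hη with rfl | rfl <;> norm_num
  have hηabs : |η| = 1 := by rcases hη with rfl | rfl <;> norm_num
  -- the non-negative function
  set g : ℝ → ℝ := fun x ↦ A * Real.sqrt x - η * (liouvilleSum x : ℝ) with hg
  have hgm : Measurable g :=
    (measurable_const.mul Real.continuous_sqrt.measurable).sub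
      (measurable_const.mul measurable_liouvilleSum)
  have hX₁ : (1 : ℝ) ≤ max x₁ 1 := le_max_right _ _
  have hpos : ∀ x, max x₁ 1 < x → 0 ≤ g x := fun x hx ↦
    sub_nonneg.2 (hb x ((le_max_left _ _).trans hx.le))
  -- absolute convergence at `σ₁ = 2`
  have hint : IntegrableOn (fun x ↦ g x * x ^ (-((2 : ℝ) + 1))) (Set.Ioi 1) := by
    refine Integrable.mono'
      ((integrableOn_Ioi_rpow_of_lt (by norm_num : (-2 : ℝ) < -1) zero_lt_one).const_mul (|A| + 1))
      ((hgm.mul (measurable_id.pow_const _)).aestronglyMeasurable) ?_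
    rw [ae_restrict_iff' measurableSet_Ioi]
    refine ae_of_all _ fun x hx ↦ ?_
    have hx1 : 1 < x := hx
    have hx0 : 0 < x := by linarith
    have hsx : Real.sqrt x ≤ x := by
      have h1 : 1 ≤ Real.sqrt x := Real.one_le_sqrt.mpr hx1.le
      nlinarith [Real.mul_self_sqrt hx0.le, Real.sqrt_nonneg x]
    have hgx : |g x| ≤ (|A| + 1) * x := by
      simp only [hg]
      calc |A * Real.sqrt x - η * (liouvilleSum x : ℝ)|
          ≤ |A * Real.sqrt x| + |η * (liouvilleSum x : ℝ)| := abs_sub _ _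
        _ = |A| * Real.sqrt x + |(liouvilleSum x : ℝ)| := by
            rw [abs_mul, abs_mul, hηabs, one_mul, abs_of_nonneg (Real.sqrt_nonneg x)]
        _ ≤ |A| * x + x := add_le_add (mul_le_mul_of_nonneg_left hsx (abs_nonneg A))
            (abs_liouvilleSum_le hx0.le)
        _ = (|A| + 1) * x := by ring
    rw [Real.norm_eq_abs, abs_mul, abs_of_nonneg (Real.rpow_nonneg hx0.le _)]
    calc |g x| * x ^ (-((2 : ℝ) + 1)) ≤ (|A| + 1) * x * x ^ (-((2 : ℝ) + 1)) :=
          mul_le_mul_of_nonneg_right hgx (Real.rpow_nonneg hx0.le _)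
      _ = (|A| + 1) * x ^ (-2 : ℝ) := by
          rw [show (-((2 : ℝ) + 1)) = -2 - 1 by norm_num, Real.rpow_sub hx0, Real.rpow_one]
          field_simp
  -- the continuation `Φ(s) = A/(s - ½) - η ζ(2s)/(s ζ(s))`, holomorphic on a neighbourhood of `(½, ∞)`
  obtain ⟨d0, hd0, hd0ζ⟩ := exists_zetaZeroFree_rect
  set W₀ : Set ℂ := {s : ℂ | 1 / 2 < s.re ∧ s.re < 4 ∧ -d0 < s.im ∧ s.im < d0} with hW₀
  set Φ : ℂ → ℂ := fun s ↦ (A : ℂ) / (s - 1 / 2) -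
    (η : ℂ) * (riemannZeta (2 * s) * (MertensBoundRH.zetaInv s / s)) with hΦ
  have hW₀o : IsOpen W₀ := by
    refine ((isOpen_lt continuous_const Complex.continuous_re).inter
      ((isOpen_lt Complex.continuous_re continuous_const).inter
      ((isOpen_lt continuous_const Complex.continuous_im).inter
      (isOpen_lt Complex.continuous_im continuous_const))))
  have hW₀c : Convex ℝ W₀ := by
    have : W₀ = {s : ℂ | 1 / 2 < s.re} ∩ ({s : ℂ | s.re < 4} ∩ ({s : ℂ | -d0 < s.im} ∩
        {s : ℂ | s.im < d0})) := by
      ext s; simp [hW₀]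
    rw [this]
    exact (convex_halfSpace_re_gt _).inter ((convex_halfSpace_re_lt _).inter
      ((convex_halfSpace_im_gt _).inter (convex_halfSpace_im_lt _)))
  have hW₀r : ∀ σ' : ℝ, 1 / 2 < σ' → σ' ≤ 2 + 1 → (σ' : ℂ) ∈ W₀ := by
    intro σ' h1 h2
    simp only [hW₀, Set.mem_setOf_eq, Complex.ofReal_re, Complex.ofReal_im]
    exact ⟨h1, by linarith, by linarith, hd0⟩
  have hΦd : DifferentiableOn ℂ Φ ({s : ℂ | 2 < s.re} ∪ W₀) := by
    intro s hs
    apply DifferentiableAt.differentiableWithinAt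
    have hre : 1 / 2 < s.re := by
      rcases hs with hs | hs
      · simp only [Set.mem_setOf_eq] at hs; linarith
      · exact hs.1
    have hs0 : s ≠ 0 := by
      intro h; rw [h] at hre; simp at hre; linarith
    have hs12 : s - 1 / 2 ≠ 0 := by
      intro h; have := congrArg Complex.re h; simp at this; linarith
    have h2s : 2 * s ≠ 1 := by
      intro h; have := congrArg Complex.re h; simp at this; linarith
    have hζ : s = 1 ∨ riemannZeta s ≠ 0 := by
      rcases hs with hs | hs
      · right
        simp only [Set.mem_setOf_eq] at hs
        exact riemannZeta_ne_zero_of_one_lt_re (by linarith)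
      · by_cases h1 : s = 1
        · exact Or.inl h1
        · exact Or.inr (hd0ζ s hs.1.le (by linarith [hs.2.1]) (abs_lt.2 ⟨hs.2.2.1, hs.2.2.2⟩))
    have d1 : DifferentiableAt ℂ (fun z : ℂ ↦ (A : ℂ) / (z - 1 / 2)) s :=
      (differentiableAt_const _).div (differentiableAt_id.sub_const _) hs12
    have d2 : DifferentiableAt ℂ (fun z : ℂ ↦ MertensBoundRH.zetaInv z / z) s :=
      (differentiableAt_zetaInv hζ).div differentiableAt_id hs0
    have d4 : DifferentiableAt ℂ (fun z : ℂ ↦ riemannZeta (2 * z)) s :=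
      (differentiableAt_riemannZeta h2s).comp s ((differentiableAt_const _).mul differentiableAt_id)
    have d3 : DifferentiableAt ℂ
        (fun z : ℂ ↦ (η : ℂ) * (riemannZeta (2 * z) * (MertensBoundRH.zetaInv z / z))) s :=
      (d4.mul d2).const_mul _
    exact d1.sub d3
  have hagree : EqOn Φ (Landau.mellinIoi g) {s : ℂ | 2 < s.re} := by
    intro s hs
    simp only [Set.mem_setOf_eq] at hs
    have hs1 : 1 < s.re := by linarith
    have hs12 : 1 / 2 < s.re := by linarith
    have hsne1 : s ≠ 1 := by
      intro h; rw [h] at hs; norm_num at hs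
    have h1 := integral_sqrt_mul_cpow hs12
    have h2 := mellin_liouvilleSum hs1
    unfold Landau.mellinIoi at h2 ⊢
    have hsplit : ∀ x : ℝ, ((g x : ℝ) : ℂ) * (x : ℂ) ^ (-(s + 1)) =
        (A : ℂ) * (((Real.sqrt x : ℝ) : ℂ) * (x : ℂ) ^ (-(s + 1))) -
          (η : ℂ) * ((((liouvilleSum x : ℝ)) : ℂ) * (x : ℂ) ^ (-(s + 1))) := by
      intro x; simp only [hg]; push_cast; ring
    simp_rw [hsplit]
    rw [integral_sub ((integrableOn_sqrt_mul_cpow hs12).const_mul _)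
      ((integrableOn_liouville_mul_cpow hs1).const_mul _), integral_const_mul, integral_const_mul,
      h1, h2]
    simp only [hΦ, MertensBoundRH.zetaInv_of_ne_one hsne1]
    have hs0 : s ≠ 0 := by
      intro h; rw [h] at hs; norm_num at hs
    have hζ0 : riemannZeta s ≠ 0 := riemannZeta_ne_zero_of_one_lt_re hs1
    field_simp
  -- Landau's lemma
  have hL := Landau.integrableOn_of_differentiableOn_union_convex hgm hint hX₁ hpos
    (by norm_num : (1 / 2 : ℝ) < 2) hW₀o hW₀c hW₀r hΦd hagree hσ
  -- back to `L = η (A√x - g)`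
  have hM : ∀ x : ℝ, (liouvilleSum x : ℝ) * x ^ (-(σ + 1)) =
      η * A * (Real.sqrt x * x ^ (-(σ + 1))) - η * (g x * x ^ (-(σ + 1))) := by
    intro x
    simp only [hg]
    linear_combination (-((liouvilleSum x : ℝ) * x ^ (-(σ + 1)))) * hηsq
  have : (fun x ↦ (liouvilleSum x : ℝ) * x ^ (-(σ + 1))) = fun x ↦
      η * A * (Real.sqrt x * x ^ (-(σ + 1))) - η * (g x * x ^ (-(σ + 1))) := funext hM
  rw [this]
  exact ((integrableOn_sqrt_mul_rpow hσ).const_mul _).sub (hL.const_mul _)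

/-! ## Analytic continuation: `∫_1^∞ L(x) x^{-s-1} dx · sζ(s) = ζ(2s)` on `Re s > ½` -/

/-- **Analytic continuation of the Mellin representation**: if `∫_1^∞ |L(x)| x^{-σ-1} dx < ∞`
for every `σ > ½`, then `(∫_1^∞ L(x) x^{-s-1} dx) · s ζ(s) = ζ(2s)` for all `Re s > ½`, `s ≠ 1`
(identity theorem on the convex pieces of `exists_convex_piece`). This is the step "the Riemann
hypothesis follows" of Pólya's and Ingham's remarks (BFM 2008 §1). [cite: BorweinFergusonMossinghoff2008, §1 pp. 1681–1682] -/
theorem mellin_liouville_mul_eq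
    (hI : ∀ σ : ℝ, 1 / 2 < σ → IntegrableOn (fun x ↦ (liouvilleSum x : ℝ) * x ^ (-(σ + 1))) (Set.Ioi 1))
    {s : ℂ} (hs : 1 / 2 < s.re) (hs1 : s ≠ 1) :
    Landau.mellinIoi (fun x ↦ (liouvilleSum x : ℝ)) s * (s * riemannZeta s) = riemannZeta (2 * s) := by
  set F : ℂ → ℂ := Landau.mellinIoi (fun x ↦ (liouvilleSum x : ℝ)) with hF
  have hFd : DifferentiableOn ℂ F {z : ℂ | 1 / 2 < z.re} :=
    Landau.differentiableOn_mellinIoi_of_forall measurable_liouvilleSum hI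
  obtain ⟨V, hVo, hVc, hsV, hVsub, h1V, z₀, hz₀V, hz₀⟩ := exists_convex_piece hs hs1
  set Ψ : ℂ → ℂ := fun z ↦ F z * (z * riemannZeta z) - riemannZeta (2 * z) with hΨ
  have hΨd : DifferentiableOn ℂ Ψ V := by
    intro z hz
    have hz1 : z ≠ 1 := fun h ↦ h1V (h ▸ hz)
    have h2z : 2 * z ≠ 1 := by
      intro h; have := congrArg Complex.re h
      have hz' := hVsub hz
      simp only [Set.mem_setOf_eq] at hz'
      simp at this; linarith
    refine ((((hFd z (hVsub hz)).differentiableAt ((isOpen_lt continuous_const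
      Complex.continuous_re).mem_nhds (hVsub hz))).mul
      (differentiableAt_id.mul (differentiableAt_riemannZeta hz1))).sub
      ((differentiableAt_riemannZeta h2z).comp z
        ((differentiableAt_const _).mul differentiableAt_id))).differentiableWithinAt
  have hΨa : AnalyticOnNhd ℂ Ψ V := hΨd.analyticOnNhd hVo
  have hev : Ψ =ᶠ[𝓝 z₀] 0 := by
    have ho : IsOpen (V ∩ {z : ℂ | 1 < z.re}) :=
      hVo.inter (isOpen_lt continuous_const Complex.continuous_re)
    filter_upwards [ho.mem_nhds ⟨hz₀V, hz₀⟩] with z hz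
    have hz1 : 1 < z.re := hz.2
    simp only [hΨ, hF, Pi.zero_apply, mellin_liouvilleSum hz1]
    have hζ := riemannZeta_ne_zero_of_one_lt_re hz1
    have hz0 : z ≠ 0 := by rintro rfl; simp at hz1; linarith
    field_simp
    ring
  have hzero := hΨa.eqOn_zero_of_preconnected_of_eventuallyEq_zero hVc.isPreconnected hz₀V hev
  have := hzero hsV
  simp only [hΨ, Pi.zero_apply, sub_eq_zero] at this
  exact this

/-- Corollary: under the same hypothesis `ζ(s) ≠ 0` for `Re s > ½` — **a one-sided bound
`L(x) < c√x` or `L(x) > -c√x` implies the Riemann hypothesis** (Ingham 1942, as quoted in BFM 2008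
§1 p. 1682; `ζ(2s) ≠ 0` for `Re s > ½`). [cite: BorweinFergusonMossinghoff2008, §1 p. 1682] -/
theorem riemannZeta_ne_zero_of_liouville_integrable
    (hI : ∀ σ : ℝ, 1 / 2 < σ → IntegrableOn (fun x ↦ (liouvilleSum x : ℝ) * x ^ (-(σ + 1))) (Set.Ioi 1))
    {s : ℂ} (hs : 1 / 2 < s.re) : riemannZeta s ≠ 0 := by
  by_cases hs1 : s = 1
  · rw [hs1]; exact riemannZeta_one_ne_zero
  · intro h0
    have := mellin_liouville_mul_eq hI hs hs1
    rw [h0, mul_zero, mul_zero] at this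
    exact riemannZeta_ne_zero_of_one_lt_re (s := 2 * s) (by simp; linarith) this.symm

/-- Corollary: the Mellin representation `∫_1^∞ L(x) x^{-s-1} dx = ζ(2s)/(s ζ(s))` on `Re s > ½`,
`s ≠ 1`. [cite: BorweinFergusonMossinghoff2008, §1 p. 1681] -/
theorem mellin_liouville_eq_of_integrable
    (hI : ∀ σ : ℝ, 1 / 2 < σ → IntegrableOn (fun x ↦ (liouvilleSum x : ℝ) * x ^ (-(σ + 1))) (Set.Ioi 1))
    {s : ℂ} (hs : 1 / 2 < s.re) (hs1 : s ≠ 1) :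
    Landau.mellinIoi (fun x ↦ (liouvilleSum x : ℝ)) s = riemannZeta (2 * s) / (s * riemannZeta s) := by
  have h := mellin_liouville_mul_eq hI hs hs1
  have hζ := riemannZeta_ne_zero_of_liouville_integrable hI hs
  have hs0 : s ≠ 0 := by rintro rfl; simp at hs; linarith
  rw [eq_div_iff (mul_ne_zero hs0 hζ), h]

/-! ## The Laplace transform of `A` under a one-sided bound -/

/-- **The Laplace input of the kernel theorem for `L`** (Ingham 1942 / BFM 2008 (3)–(5)): under a
one-sided bound `A ≤ a` or `A ≥ -a` on `A(u) = L(e^u)e^{-u/2}`, the damped functions `A(u)e^{-σu}`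
are integrable for every `σ > 0` (Landau), and for `0 < σ < ½` and all real `t`,
`∫ A(u) e^{-(σ+it)u} du = ζ(1+2(σ+it))/((½+σ+it) ζ(½+σ+it))`.
[cite: BorweinFergusonMossinghoff2008, §1 (3)–(5) p. 1683] -/
theorem normalizedLiouville_laplace_of_oneSided {a : ℝ}
    (h : (∀ u, normalizedLiouville u ≤ a) ∨ (∀ u, -a ≤ normalizedLiouville u)) :
    (∀ σ : ℝ, 0 < σ → Integrable (fun u ↦ normalizedLiouville u * Real.exp (-(σ * u)))) ∧
    ∀ σ t : ℝ, 0 < σ → σ < 1 / 2 →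
      ∫ u : ℝ, (normalizedLiouville u : ℂ) * cexp (-(((σ : ℂ) + t * I) * u)) =
        riemannZeta (2 * (1 / 2 + σ + t * I)) /
          ((1 / 2 + σ + t * I) * riemannZeta (1 / 2 + σ + t * I)) := by
  -- the one-sided bound in the `x`-variable and Landau
  have hI : ∀ σ : ℝ, 1 / 2 < σ →
      IntegrableOn (fun x ↦ (liouvilleSum x : ℝ) * x ^ (-(σ + 1))) (Set.Ioi 1) := by
    intro σ hσ
    rcases h with h | h
    · refine integrableOn_liouville_rpow_of_oneSided (η := 1) (x₁ := 1) (A := a) (Or.inl rfl)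
        (fun x hx ↦ ?_) hσ
      rw [one_mul]; exact liouville_le_of_normalizedLiouville_le h (by linarith)
    · refine integrableOn_liouville_rpow_of_oneSided (η := -1) (x₁ := 1) (A := a) (Or.inr rfl)
        (fun x hx ↦ ?_) hσ
      have := liouville_ge_of_le_normalizedLiouville h (show (0 : ℝ) < x by linarith)
      linarith
  refine ⟨fun σ hσ ↦ ?_, fun σ t hσ hσ' ↦ ?_⟩
  · rw [integrable_normalizedLiouville_damped_iff]
    exact hI _ (by linarith)
  · have hs : 1 / 2 < ((1 / 2 : ℂ) + σ + t * I).re := by simp; exact hσ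
    have hs1 : (1 / 2 : ℂ) + σ + t * I ≠ 1 := by
      intro h1
      have := congrArg Complex.re h1
      simp at this; linarith
    rw [← mellin_liouville_eq_of_integrable hI hs hs1, ← laplace_normalizedLiouville_eq_mellin]
    refine integral_congr_ae (ae_of_all _ fun u ↦ ?_)
    dsimp only
    congr 2
    ring

end Literature.NumberTheory.LFunctions
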